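import Summits.PneNP.PneNP.Theorems.SymmetryBudgetWindowBarrierEntropyGameCircuit
import Summits.PneNP.PneNP.Theorems.SymmetryBudgetWindowBarrierEntropyGameBlockGroup
import Literature.Computability.AlgebraicComplexity.MultinomialWords
import Mathlib.Data.Finsupp.Multiset
import Mathlib.Data.Sym.Card
import Mathlib.Data.Nat.Choose.Bounds

/-!
# Completeness of the entropy game, V: counting types and positions
(dichotomy `WindowBarrier` stmt-PneNP-2145 / `NoHiddenOrder` stmt-PneNP-14781, route `PneNP/SymmetryBudget`)

The size of the coset-refinement circuit (`…EntropyGameCircuit.lean`) is governed by the number of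
types `|Ty n K|` and the number of positions of a type `|Cos A|`.  Both are `2^{O((K+1) n)}`:

* `CosetGame.card_cos_le`: `|Cos A| ≤ 2^n · 2^{Kn}` (`index_blockGroup_le` of `…EntropyGameBlockGroup.lean`);
* `CosetGame.card_ty_le`: `|Ty n K| ≤ 2^{2n} · 2^{Kn}` — a type is the block group of a CANONICAL labelling
  (each point labelled by the least point of its class, `CosetGame.canon`), an injection into the words
  `Fin n → Fin n` of entropy `≤ K n`; words are counted fibrewise over their letter counts
  (`Literature.Computability.AlgebraicComplexity.card_words_eq_multinomial`: a fibre is a multinomial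
  coefficient, `≤ 2^{Kn}` for an admissible count vector by `Nat.multinomial_spec`), and count vectors
  summing to `n` are `n`-multisets over `Fin n` (`Sym.equivNatSumOfFintype`), at most
  `C(2n-1, n) ≤ 2^{2n}` of them.
-/

-- `Summit.PneNP.PneNP.…` duplicates `PneNP` BY DESIGN (single-problem summit).
set_option linter.dupNamespace false

namespace Summit.PneNP.PneNP.Theorems

open Finset Literature.Computability.Complexity Literature.Computability.AlgebraicComplexity
open scoped Classical

namespace CosetGame

variable {n K : ℕ}

noncomputable section

/-! ### Positions of a type -/

/-- **`|Cos A| ≤ 2^n · 2^{Kn}`.** -/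
theorem card_cos_le (A : Ty n K) : Fintype.card (Cos A) ≤ 2 ^ n * 2 ^ (K * n) := by
  obtain ⟨μ, hμ, hA⟩ := A.2
  have h1 : Fintype.card (Cos A) = (A.1).index := by
    rw [Subgroup.index, Nat.card_eq_fintype_card]
  rw [h1]
  have h2 := index_blockGroup_le hμ
  rw [hA] at h2
  exact h2

/-! ### Canonical labellings -/

/-- The canonical labelling with the level sets of `μ`: each point gets the least point of its class. -/
def canon (μ : Fin n → ℕ) : Fin n → Fin n :=
  fun u => (univ.filter fun v => μ v = μ u).min' ⟨u, by simp⟩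

/-- The canonical labelling has the level sets of `μ`. -/
theorem canon_eq_iff (μ : Fin n → ℕ) (u v : Fin n) : canon μ u = canon μ v ↔ μ u = μ v := by
  constructor
  · intro h
    have hu : canon μ u ∈ univ.filter fun w => μ w = μ u := Finset.min'_mem _ _
    have hv : canon μ v ∈ univ.filter fun w => μ w = μ v := Finset.min'_mem _ _
    rw [h] at hu
    simp only [mem_filter, mem_univ, true_and] at hu hv
    exact hu.symm.trans hv
  · intro h
    unfold canon
    congr 1
    ext w
    simp [h]

/-- Block groups only depend on the level sets. -/
theorem blockGroup_eq_of_iff {μ ν : Fin n → ℕ} (h : ∀ u v, μ u = μ v ↔ ν u = ν v) :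
    blockGroup μ = blockGroup ν := by
  unfold blockGroup
  congr 1
  ext σ
  simp only [Set.mem_setOf_eq]
  constructor
  · rintro ⟨u, v, w, h1, h2, h3, h4, h5, rfl⟩
    exact ⟨u, v, w, h1, h2, h3, (h u v).1 h4, (h v w).1 h5, rfl⟩
  · rintro ⟨u, v, w, h1, h2, h3, h4, h5, rfl⟩
    exact ⟨u, v, w, h1, h2, h3, (h u v).2 h4, (h v w).2 h5, rfl⟩

/-- The entropy only depends on the level sets. -/
theorem isLowEntropy_of_iff {μ ν : Fin n → ℕ} (h : ∀ u v, μ u = μ v ↔ ν u = ν v) (hμ : IsLowEntropy K μ) :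
    IsLowEntropy K ν := by
  unfold IsLowEntropy at hμ ⊢
  have hprod : ∏ i ∈ univ.image μ, ((univ.filter fun u : Fin n => μ u = i).card).factorial =
      ∏ j ∈ univ.image ν, ((univ.filter fun u : Fin n => ν u = j).card).factorial := by
    -- reindex the classes by a point of each
    refine Finset.prod_bij' (fun i hi => ν (Classical.choose (mem_image.1 hi)))
      (fun j hj => μ (Classical.choose (mem_image.1 hj))) (fun i hi => mem_image_of_mem ν (mem_univ _))
      (fun j hj => mem_image_of_mem μ (mem_univ _)) (fun i hi => ?_) (fun j hj => ?_) (fun i hi => ?_)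
    · -- left inverse
      have h1 := (Classical.choose_spec (mem_image.1 hi)).2
      set u := Classical.choose (mem_image.1 hi)
      have hj : ν u ∈ univ.image ν := mem_image_of_mem ν (mem_univ _)
      have h2 := (Classical.choose_spec (mem_image.1 hj)).2
      set w := Classical.choose (mem_image.1 hj)
      rw [← h1]
      exact (h w u).2 h2
    · have h1 := (Classical.choose_spec (mem_image.1 hj)).2
      set u := Classical.choose (mem_image.1 hj)
      have hi : μ u ∈ univ.image μ := mem_image_of_mem μ (mem_univ _)
      have h2 := (Classical.choose_spec (mem_image.1 hi)).2
      set w := Classical.choose (mem_image.1 hi)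
      rw [← h1]
      exact (h w u).1 h2
    · have h1 := (Classical.choose_spec (mem_image.1 hi)).2
      set u := Classical.choose (mem_image.1 hi)
      congr 2
      ext w
      simp only [mem_filter, mem_univ, true_and]
      rw [← h1]
      exact h w u
  rw [← hprod]
  exact hμ

/-- The canonical labelling of a type: read back into `ℕ`, a labelling of entropy `≤ K n` with the
same block group. -/
theorem canon_spec (A : Ty n K) :
    IsLowEntropy K (fun u => (canon (Classical.choose A.2) u : ℕ)) ∧
      blockGroup (fun u => (canon (Classical.choose A.2) u : ℕ)) = A.1 := by
  obtain ⟨hμ, hA⟩ := Classical.choose_spec A.2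
  have hiff : ∀ u v, Classical.choose A.2 u = Classical.choose A.2 v ↔
      (canon (Classical.choose A.2) u : ℕ) = canon (Classical.choose A.2) v := fun u v => by
    rw [Fin.val_inj, canon_eq_iff]
  exact ⟨isLowEntropy_of_iff hiff hμ, (blockGroup_eq_of_iff hiff).symm.trans hA⟩

/-- The admissible words: labellings into `Fin n` of entropy `≤ K n`. -/
abbrev AdmWord (n K : ℕ) : Type := {w : Fin n → Fin n // IsLowEntropy K fun u => (w u : ℕ)}

/-- **Types inject into admissible words.** -/
theorem card_ty_le_card_admWord : Fintype.card (Ty n K) ≤ Fintype.card (AdmWord n K) := by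
  refine Fintype.card_le_of_injective (fun A => ⟨canon (Classical.choose A.2), (canon_spec A).1⟩) ?_
  intro A B h
  have h' : canon (Classical.choose A.2) = canon (Classical.choose B.2) := congrArg Subtype.val h
  apply Subtype.ext
  rw [← (canon_spec A).2, ← (canon_spec B).2, h']

/-! ### Counting admissible words -/

/-- Letter counts of a word over `Fin n`. -/
abbrev lc (w : Fin n → Fin n) (v : Fin n) : ℕ := (univ.filter fun t => w t = v).card

/-- Letter counts sum to the length. -/
theorem sum_lc (w : Fin n → Fin n) : ∑ v, lc w v = n := by
  have h := Finset.card_eq_sum_card_fiberwise (f := w) (s := Finset.univ) (t := Finset.univ)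
    fun _ _ => Finset.mem_coe.2 (Finset.mem_univ _)
  simp only [Finset.card_univ, Fintype.card_fin] at h
  exact h.symm

/-- The entropy product of a word over `Fin n` is the product of the factorials of ALL letter counts
(absent letters contribute `0! = 1`). -/
theorem prod_image_eq_prod_lc (w : Fin n → Fin n) :
    ∏ i ∈ univ.image (fun u => (w u : ℕ)), ((univ.filter fun u : Fin n => (w u : ℕ) = i).card).factorial =
      ∏ v : Fin n, (lc w v).factorial := by
  have h1 : (univ.image fun u => (w u : ℕ)) = (univ.image w).map Fin.valEmbedding := by
    ext i; simp [Fin.valEmbedding]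
  rw [h1, Finset.prod_map]
  have h2 : ∀ v : Fin n, (univ.filter fun u : Fin n => (w u : ℕ) = Fin.valEmbedding v).card = lc w v :=
    fun v => by
      congr 1; ext u; simp [Fin.valEmbedding, Fin.val_inj]
  simp only [h2]
  refine Finset.prod_subset (Finset.subset_univ _) fun v _ hv => ?_
  have : lc w v = 0 := by
    rw [Finset.card_eq_zero, Finset.filter_eq_empty_iff]
    intro u _ hu
    exact hv (mem_image.2 ⟨u, mem_univ _, hu⟩)
  rw [this, Nat.factorial_zero]

/-- A word is admissible iff its letter-count vector is: `n! ≤ 2^{Kn} ∏ (count v)!`. -/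
theorem admissible_iff (w : Fin n → Fin n) :
    IsLowEntropy K (fun u => (w u : ℕ)) ↔ n.factorial ≤ 2 ^ (K * n) * ∏ v : Fin n, (lc w v).factorial := by
  unfold IsLowEntropy
  rw [prod_image_eq_prod_lc]

/-- An admissible count vector has multinomial `≤ 2^{Kn}`. -/
theorem multinomial_le_of_admissible (k : Fin n → ℕ) (hk : ∑ v, k v = n)
    (h : n.factorial ≤ 2 ^ (K * n) * ∏ v : Fin n, (k v).factorial) : Nat.multinomial univ k ≤ 2 ^ (K * n) := by
  have hspec := Nat.multinomial_spec (univ : Finset (Fin n)) k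
  rw [hk] at hspec
  have hpos : 0 < ∏ v : Fin n, (k v).factorial := Finset.prod_pos fun v _ => Nat.factorial_pos _
  refine Nat.le_of_mul_le_mul_left ?_ hpos
  rw [hspec, mul_comm]
  exact h

/-- Count vectors summing to `n` are at most `2^{2n}` (they are the `n`-multisets over `Fin n`). -/
theorem card_image_lc_le :
    ((univ : Finset (Fin n → Fin n)).image lc).card ≤ 2 ^ (2 * n) := by
  have hsum : ∀ w : Fin n → Fin n, ∑ v, lc w v = n := fun w => by
    have := sum_lc w
    simpa using this
  -- inject into `Sym (Fin n) n`
  have h1 : ((univ : Finset (Fin n → Fin n)).image lc).card ≤ Fintype.card (Sym (Fin n) n) := by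
    let φ : {k // k ∈ (univ : Finset (Fin n → Fin n)).image lc} → Sym (Fin n) n := fun k =>
      (Sym.equivNatSumOfFintype (Fin n) n).symm ⟨k.1, by
        obtain ⟨w, -, hw⟩ := mem_image.1 k.2
        rw [← hw]; exact hsum w⟩
    have hφ : Function.Injective φ := by
      intro k₁ k₂ h
      have h' := (Sym.equivNatSumOfFintype (Fin n) n).symm.injective h
      have hv : (k₁ : Fin n → ℕ) = k₂ := congrArg (fun p : {P : Fin n → ℕ // ∑ i, P i = n} => (p : Fin n → ℕ)) h'
      exact Subtype.ext hv
    have := Fintype.card_le_of_injective φ hφ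
    rwa [Fintype.card_coe] at this
  refine h1.trans ?_
  rw [Sym.card_sym_eq_choose, Fintype.card_fin]
  exact (Nat.choose_le_two_pow _ _).trans (Nat.pow_le_pow_right Nat.two_pos (by omega))

/-- **Admissible words are at most `2^{2n} · 2^{Kn}`.** -/
theorem card_admWord_le : Fintype.card (AdmWord n K) ≤ 2 ^ (2 * n) * 2 ^ (K * n) := by
  rw [Fintype.card_subtype]
  set S := univ.filter fun w : Fin n → Fin n => IsLowEntropy K fun u => (w u : ℕ) with hS
  have hfib := Finset.card_eq_sum_card_fiberwise (s := S) (t := (univ : Finset (Fin n → Fin n)).image lc)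
    (f := lc) fun w _ => mem_image_of_mem _ (mem_univ w)
  rw [hfib]
  have hsum : ∀ w : Fin n → Fin n, ∑ v, lc w v = n := fun w => by
    have := sum_lc w
    simpa using this
  have hterm : ∀ k ∈ (univ : Finset (Fin n → Fin n)).image lc,
      (S.filter fun w => lc w = k).card ≤ 2 ^ (K * n) := by
    intro k hk
    obtain ⟨w₀, -, rfl⟩ := mem_image.1 hk
    by_cases hadm : n.factorial ≤ 2 ^ (K * n) * ∏ v : Fin n, (lc w₀ v).factorial
    · calc (S.filter fun w => lc w = lc w₀).card
          ≤ (univ.filter fun w : Fin n → Fin n => ∀ v, (univ.filter fun t => w t = v).card = lc w₀ v).card := by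
            refine Finset.card_le_card fun w hw => ?_
            simp only [mem_filter, mem_univ, true_and] at hw ⊢
            intro v
            rw [← hw.2]
        _ = Nat.multinomial univ (lc w₀) := by convert card_words_eq_multinomial n (lc w₀) (hsum w₀) using 3
        _ ≤ 2 ^ (K * n) := multinomial_le_of_admissible _ (hsum w₀) hadm
    · have h0 : (S.filter fun w => lc w = lc w₀).card = 0 := by
        rw [Finset.card_eq_zero, Finset.filter_eq_empty_iff]
        intro w hw hlc
        rw [hS] at hw
        simp only [mem_filter, mem_univ, true_and] at hw
        rw [admissible_iff, hlc] at hw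
        exact hadm hw
      rw [h0]; exact Nat.zero_le _
  calc ∑ k ∈ (univ : Finset (Fin n → Fin n)).image lc, (S.filter fun w => lc w = k).card
      ≤ ∑ _k ∈ (univ : Finset (Fin n → Fin n)).image lc, 2 ^ (K * n) := Finset.sum_le_sum hterm
    _ = ((univ : Finset (Fin n → Fin n)).image lc).card * 2 ^ (K * n) := by
        rw [Finset.sum_const, smul_eq_mul]
    _ ≤ 2 ^ (2 * n) * 2 ^ (K * n) := Nat.mul_le_mul_right _ card_image_lc_le

/-- **`|Ty n K| ≤ 2^{2n} · 2^{Kn}`.** -/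
theorem card_ty_le : Fintype.card (Ty n K) ≤ 2 ^ (2 * n) * 2 ^ (K * n) :=
  card_ty_le_card_admWord.trans card_admWord_le

end

end CosetGame

end Summit.PneNP.PneNP.Theorems
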